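import Literature.Analysis.Prevalence.Basic

/-!
# Shy sets: finite unions and the finite-dimensional case

Continuation of `Literature.Analysis.Prevalence.Basic` (Hunt–Sauer–Yorke [HuntSauerYorke1992, §2]).

* `conv_apply_eq_lintegral_left/right` — HSY Definition 3: the convolution `μ ∗ ν` (Mathlib's
  `MeasureTheory.Measure.conv`, the image of `μ.prod ν` under addition) satisfies
  `(μ ∗ ν) B = ∫ ν (B - x) dμ(x) = ∫ μ (B - y) dν(y)` (Fubini–Tonelli).
* `IsTransverse.conv`, `IsTransverse.conv_left` — **HSY Fact 3**: if `μ` is transverse to a Borel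
  set `S` and `ν` is a finite measure charging a compact set, then `μ ∗ ν` (and `ν ∗ μ`) is
  transverse to `S`.
* `IsShy.union`, `isShy_biUnion_finset`, `Set.Finite.isShy_biUnion`, `isShy_iUnion_of_finite`,
  `IsPrevalent.inter`, `isPrevalent_iInter_of_finite` — **HSY Fact 3′**: finite unions of shy sets
  are shy; finite intersections of prevalent sets are prevalent.
* `IsShy.addHaar_eq_zero`, `isShy_of_addHaar_eq_zero`, `isShy_iff_addHaar_eq_zero`,
  `isPrevalent_iff_addHaar_ae` — **HSY Fact 6** (stated for any second-countable locally compact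
  abelian group with a Haar measure `ρ`, in particular `ℝⁿ` with Lebesgue measure): a set is shy
  iff it is Haar-null; a set is prevalent iff Haar-a.e. point belongs to it.

## Hypotheses

The Fubini arguments need addition `V × V → V` to be measurable for the product σ-algebra
(`[MeasurableAdd₂ V]`, automatic for a second-countable Borel topological group) and, for the
compact set charged by `μ ∗ ν`, `[ContinuousAdd V]`. HSY state Facts 3, 3′ for complete metric
linear spaces without separability; their measures have compact (hence separable) support, a
reduction not carried out here. TODO(general form): drop second countability.

Countable unions (HSY Fact 3″) are in `CountableUnion.lean`.

## References

* B. R. Hunt, T. Sauer, J. A. Yorke, *Prevalence*, Bull. AMS 27 (1992) 217–238, §2 (Definition 3,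
  Facts 3, 3′, 6). [HuntSauerYorke1992]
-/

open MeasureTheory Set Filter
open scoped Pointwise ENNReal Topology

namespace Literature.Analysis.Prevalence

variable {V : Type*} [AddCommGroup V] [MeasurableSpace V] {S T : Set V}

/-! ### Convolution of measures evaluated on a set (HSY Definition 3) -/

section Conv

variable [MeasurableAdd₂ V]

/-- **HSY Definition 3 / Fubini**: `(μ ∗ ν) B = ∫ ν (B - x) dμ(x)`, written with Mathlib's
left translates: `B - x = (-x) +ᵥ B`. [cite: HuntSauerYorke1992, §2 Definition 3] -/
theorem conv_apply_eq_lintegral_left (μ ν : Measure V) [SFinite ν] {B : Set V}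
    (hB : MeasurableSet B) : (μ ∗ ν) B = ∫⁻ x, ν ((-x) +ᵥ B) ∂μ := by
  rw [← lintegral_indicator_one hB, Measure.lintegral_conv (measurable_one.indicator hB)]
  refine lintegral_congr fun x => ?_
  have hx : ∀ y, B.indicator (1 : V → ℝ≥0∞) (x + y) = ((-x) +ᵥ B).indicator 1 y := fun y => by
    have hy : y ∈ (-x) +ᵥ B ↔ x + y ∈ B := by
      rw [mem_vadd_set_iff_neg_vadd_mem, neg_neg, vadd_eq_add]
    by_cases h : x + y ∈ B
    · rw [indicator_of_mem h, indicator_of_mem (hy.2 h)]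
      rfl
    · rw [indicator_of_notMem h, indicator_of_notMem (mt hy.1 h)]
  simp_rw [hx]
  exact lintegral_indicator_one (hB.const_vadd (-x))

/-- **HSY Definition 3 / Fubini**, the other order: `(μ ∗ ν) B = ∫ μ (B - y) dν(y)`.
[cite: HuntSauerYorke1992, §2 Definition 3] -/
theorem conv_apply_eq_lintegral_right (μ ν : Measure V) [SFinite μ] [SFinite ν] {B : Set V}
    (hB : MeasurableSet B) : (μ ∗ ν) B = ∫⁻ y, μ ((-y) +ᵥ B) ∂ν := by
  rw [Measure.conv_comm, conv_apply_eq_lintegral_left ν μ hB]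

/-- Every translate of a Borel set `S` is `μ ∗ ν`-null as soon as every translate is `μ`-null.
[cite: HuntSauerYorke1992, §2 Fact 3] -/
theorem conv_vadd_set_eq_zero (μ ν : Measure V) [SFinite μ] [SFinite ν] (hS : MeasurableSet S)
    (h : ∀ v : V, μ (v +ᵥ S) = 0) (v : V) : (μ ∗ ν) (v +ᵥ S) = 0 := by
  rw [conv_apply_eq_lintegral_right μ ν (hS.const_vadd v)]
  simp [vadd_vadd, h]

/-- Symmetric version of `conv_vadd_set_eq_zero`: translates of `S` are `ν ∗ μ`-null when they
are `μ`-null. [cite: HuntSauerYorke1992, §2 Fact 3] -/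
theorem conv_vadd_set_eq_zero_left (ν μ : Measure V) [SFinite μ] (hS : MeasurableSet S)
    (h : ∀ v : V, μ (v +ᵥ S) = 0) (v : V) : (ν ∗ μ) (v +ᵥ S) = 0 := by
  rw [conv_apply_eq_lintegral_left ν μ (hS.const_vadd v)]
  simp [vadd_vadd, h]

/-- The convolution of two measures charging sets `K`, `L` charges `K + L`:
`(μ ∗ ν) (K + L) ≥ μ K * ν L`. [folklore] -/
theorem mul_le_conv_add (μ ν : Measure V) [SFinite ν] (K L : Set V) :
    μ K * ν L ≤ (μ ∗ ν) (K + L) := by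
  calc μ K * ν L = μ.prod ν (K ×ˢ L) := (Measure.prod_prod K L).symm
    _ ≤ μ.prod ν ((fun p : V × V => p.1 + p.2) ⁻¹' (K + L)) :=
        measure_mono fun p hp => add_mem_add hp.1 hp.2
    _ ≤ (μ ∗ ν) (K + L) := Measure.le_map_apply measurable_add.aemeasurable _

variable [TopologicalSpace V] [ContinuousAdd V]

/-- **HSY Fact 3.** Let `μ`, `ν` be finite measures, `ν` charging some compact set. If `μ` is
transverse to a Borel set `S`, then so is `μ ∗ ν`. [cite: HuntSauerYorke1992, §2 Fact 3] -/
theorem IsTransverse.conv {μ ν : Measure V} [IsFiniteMeasure μ] [IsFiniteMeasure ν]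
    (hμ : IsTransverse μ S) (hS : MeasurableSet S) (hν : ∃ L : Set V, IsCompact L ∧ 0 < ν L) :
    IsTransverse (μ ∗ ν) S := by
  obtain ⟨K, hK, hKpos, -⟩ := hμ.1
  obtain ⟨L, hL, hLpos⟩ := hν
  refine ⟨⟨K + L, hK.add hL, ?_, measure_lt_top _ _⟩, conv_vadd_set_eq_zero μ ν hS hμ.2⟩
  exact (ENNReal.mul_pos hKpos.ne' hLpos.ne').trans_le (mul_le_conv_add μ ν K L)

/-- **HSY Fact 3**, convolving on the left: if `μ` is transverse to a Borel set `S` and `ν` is a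
finite measure charging a compact set, then `ν ∗ μ` is transverse to `S`.
[cite: HuntSauerYorke1992, §2 Fact 3] -/
theorem IsTransverse.conv_left {μ ν : Measure V} [IsFiniteMeasure μ] [IsFiniteMeasure ν]
    (hμ : IsTransverse μ S) (hS : MeasurableSet S) (hν : ∃ L : Set V, IsCompact L ∧ 0 < ν L) :
    IsTransverse (ν ∗ μ) S := by
  rw [Measure.conv_comm]
  exact hμ.conv hS hν

/-! ### Finite unions (HSY Fact 3′) -/

/-- **HSY Fact 3′** (two sets): the union of two shy sets is shy — the convolution of (probability)
transverse measures is transverse to both. [cite: HuntSauerYorke1992, §2 Fact 3′] -/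
theorem IsShy.union (hS : IsShy S) (hT : IsShy T) : IsShy (S ∪ T) := by
  obtain ⟨B, hSB, hB, μ₀, hμ₀⟩ := hS
  obtain ⟨C, hTC, hC, ν₀, hν₀⟩ := hT
  obtain ⟨μ, hμp, hμ, K, hK, hK1⟩ := hμ₀.exists_isProbabilityMeasure
  obtain ⟨ν, hνp, hν, L, hL, hL1⟩ := hν₀.exists_isProbabilityMeasure
  refine ⟨B ∪ C, union_subset_union hSB hTC, hB.union hC, μ ∗ ν, ?_⟩
  exact (hμ.conv hB ⟨L, hL, by simp [hL1]⟩).union (hν.conv_left hC ⟨K, hK, by simp [hK1]⟩)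

/-- **HSY Fact 3′**: a finite union of shy sets (indexed by a `Finset`) is shy.
[cite: HuntSauerYorke1992, §2 Fact 3′] -/
theorem isShy_biUnion_finset {ι : Type*} (s : Finset ι) {S : ι → Set V}
    (h : ∀ i ∈ s, IsShy (S i)) : IsShy (⋃ i ∈ s, S i) := by
  classical
  induction s using Finset.induction_on with
  | empty => simpa using (isShy_empty : IsShy (∅ : Set V))
  | insert a s ha ih =>
    rw [Finset.set_biUnion_insert]
    exact (h a (Finset.mem_insert_self a s)).union
      (ih fun i hi => h i (Finset.mem_insert_of_mem hi))

/-- **HSY Fact 3′**: a finite union of shy sets (indexed by a finite set) is shy.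
[cite: HuntSauerYorke1992, §2 Fact 3′] -/
theorem _root_.Set.Finite.isShy_biUnion {ι : Type*} {I : Set ι} (hI : I.Finite) {S : ι → Set V}
    (h : ∀ i ∈ I, IsShy (S i)) : IsShy (⋃ i ∈ I, S i) := by
  have := isShy_biUnion_finset hI.toFinset (S := S) (fun i hi => h i (hI.mem_toFinset.1 hi))
  simpa only [Finite.mem_toFinset] using this

/-- **HSY Fact 3′**: a finite union of shy sets (finite index type) is shy.
[cite: HuntSauerYorke1992, §2 Fact 3′] -/
theorem isShy_iUnion_of_finite {ι : Type*} [Finite ι] {S : ι → Set V} (h : ∀ i, IsShy (S i)) :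
    IsShy (⋃ i, S i) := by
  have := Set.finite_univ.isShy_biUnion (S := S) fun i _ => h i
  simpa only [mem_univ, iUnion_true] using this

/-- **HSY Fact 3′** (prevalent form): the intersection of two prevalent sets is prevalent.
[cite: HuntSauerYorke1992, §2 Fact 3′] -/
theorem IsPrevalent.inter (hS : IsPrevalent S) (hT : IsPrevalent T) : IsPrevalent (S ∩ T) := by
  rw [IsPrevalent, compl_inter]
  exact IsShy.union hS hT

/-- **HSY Fact 3′** (prevalent form): a finite intersection of prevalent sets is prevalent.
[cite: HuntSauerYorke1992, §2 Fact 3′] -/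
theorem isPrevalent_iInter_of_finite {ι : Type*} [Finite ι] {S : ι → Set V}
    (h : ∀ i, IsPrevalent (S i)) : IsPrevalent (⋂ i, S i) := by
  rw [IsPrevalent, compl_iInter]
  exact isShy_iUnion_of_finite h

/-- A prevalent set is not shy (in particular "prevalent" and "shy" are mutually exclusive, as
"full measure" and "measure zero" are): otherwise `univ = S ∪ Sᶜ` would be shy.
[cite: HuntSauerYorke1992, §2 Fact 3′] -/
theorem IsPrevalent.not_isShy (h : IsPrevalent S) : ¬ IsShy S := fun hS => by
  have : IsShy (S ∪ Sᶜ) := hS.union h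
  rw [union_compl_self] at this
  exact not_isShy_of_isOpen isOpen_univ univ_nonempty this

end Conv

/-! ### Locally compact groups: shy = Haar-null (HSY Fact 6) -/

section Haar

variable [TopologicalSpace V] [IsTopologicalAddGroup V] [BorelSpace V] [SecondCountableTopology V]
  [LocallyCompactSpace V] (ρ : Measure V) [ρ.IsAddHaarMeasure]

/-- **HSY Fact 6** (⇒, Tonelli): in a second-countable locally compact abelian group with Haar
measure `ρ` (e.g. `ℝⁿ` with Lebesgue measure), every shy set is Haar-null: if `μ` is a transverse
probability measure then `ρ B = (μ ∗ ρ) B = (ρ ∗ μ) B = ∫ μ (B - y) dρ(y) = 0`.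
[cite: HuntSauerYorke1992, §2 Fact 6] -/
theorem IsShy.addHaar_eq_zero (h : IsShy S) : ρ S = 0 := by
  obtain ⟨B, hSB, hB, μ₀, hμ₀⟩ := h
  obtain ⟨μ, hμp, hμ, -⟩ := hμ₀.exists_isProbabilityMeasure
  refine measure_mono_null hSB ?_
  have h1 : (μ ∗ ρ) B = ρ B := by
    rw [conv_apply_eq_lintegral_left μ ρ hB]
    simp [measure_vadd]
  have h2 : (μ ∗ ρ) B = 0 := by
    rw [conv_apply_eq_lintegral_right μ ρ hB]
    simp [hμ.2]
  rw [← h1, h2]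

/-- **HSY Fact 6** (⇐): in a locally compact abelian group a Haar-null set is shy — Haar measure
itself (translation invariant, charging a compact neighbourhood of `0`) is transverse to a Borel
null superset. [cite: HuntSauerYorke1992, §2 Fact 6] -/
theorem isShy_of_addHaar_eq_zero (h : ρ S = 0) : IsShy S := by
  obtain ⟨B, hSB, hB, hB0⟩ := exists_measurable_superset_of_null h
  obtain ⟨K, hK, hK0⟩ := exists_compact_mem_nhds (0 : V)
  refine ⟨B, hSB, hB, ρ, ⟨K, hK, Measure.measure_pos_of_mem_nhds ρ hK0, hK.measure_lt_top⟩,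
    fun v => ?_⟩
  rw [measure_vadd, hB0]

/-- **HSY Fact 6**: in a second-countable locally compact abelian group with Haar measure `ρ`
(in particular in `ℝⁿ`, or any finite-dimensional real normed space, with Lebesgue measure), a set
is shy iff it is Haar-null. [cite: HuntSauerYorke1992, §2 Fact 6] -/
theorem isShy_iff_addHaar_eq_zero : IsShy S ↔ ρ S = 0 :=
  ⟨fun h => h.addHaar_eq_zero ρ, isShy_of_addHaar_eq_zero ρ⟩

/-- **HSY Fact 6** (prevalent form): in a second-countable locally compact abelian group with Haar
measure `ρ`, a set is prevalent iff `ρ`-almost every point belongs to it.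
[cite: HuntSauerYorke1992, §2 Fact 6] -/
theorem isPrevalent_iff_addHaar_ae : IsPrevalent S ↔ ∀ᵐ x ∂ρ, x ∈ S := by
  rw [IsPrevalent, isShy_iff_addHaar_eq_zero ρ, ae_iff]
  rfl

/-- **HSY Fact 6** for `volume`: in a second-countable locally compact abelian group whose
canonical measure is a Haar measure (`ℝ`, `ℝⁿ = Fin n → ℝ`, `EuclideanSpace ℝ (Fin n)`, any
finite-dimensional real normed space with its `MeasureSpace` instance), shy = Lebesgue-null.
[cite: HuntSauerYorke1992, §2 Fact 6] -/
theorem isShy_iff_volume_eq_zero {E : Type*} [AddCommGroup E] [TopologicalSpace E]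
    [IsTopologicalAddGroup E] [MeasureSpace E] [BorelSpace E] [SecondCountableTopology E]
    [LocallyCompactSpace E] [(volume : Measure E).IsAddHaarMeasure] {S : Set E} :
    IsShy S ↔ volume S = 0 :=
  isShy_iff_addHaar_eq_zero volume

end Haar

end Literature.Analysis.Prevalence
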